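import Summits.ValiantsHypothesis.ValiantsHypothesis.Theorems.LacunarySymmetroidMatrixDescartesCensusDoorA34NullNullChamberOrientedH
import Summits.ValiantsHypothesis.ValiantsHypothesis.Theorems.LacunarySymmetroidMatrixDescartesCensusDoorA34NullNullChamberEndsE

/-!
# `MatrixDescartes` census — DOOR A at `(3,4)`: the END-TYPE ROWS of the null-null sheet, ORIENTATION-FREE (part H: chambers 70–79) — per exponent chamber,
# every pair of end types (S₀, S₃) killed at sign level in BOTH orientations is one theorem for all supports of the chamber

HONEST FRAMING.  Object-search cell `pub-symmetroid`, engine seat `val-sym-eng-2` (g8); helper rows beside the registered strata line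
`Cruxes/DoorA34/Lines/strata.lean` on stmt-ValiantsHypothesis-19980 (`DoorA34 = PosRootLawAt 3 4 18`: OPEN, typed, never asserted here); third stub
`stub_nullNullCeiling` (`det S₀ = det S₃ = 0 ⇒ ≤ 16`).  With the oriented chamber theorems (…NullNullChamberOrientedA–H, g8) and g6's end-cell dichotomy rows
(…NullNullChamberEndsA–E) every sign-killed (chamber, cell, orientation) class of g5's null-null atlas is kernel.  This series removes the orientation: on a
hypothetical null-null seventeen `c_{001} = tr(adj S₀·S₁) ≠ 0` (`trace_adjugate_mul_ne_zero_of_nullNull_seventeen`); for `c_{001} > 0` the oriented theorem applies to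
`S`, for `c_{001} < 0` to `−S` with the cell sign-flipped (`posRoots_pencil_neg_three`), so a cell killed in BOTH orientations is dead for every support of the
chamber with no orientation hypothesis.  Per chamber ONE theorem `card_posRoots_le_16_of_nullNull_endTypes_on_chamber<k>` (hypotheses: `StrictMono d`, the chamber
order, symmetric letters, `det S₀ = det S₃ = 0`, end types in the dead list ⇒ `Z₊ ≤ 16`); its docstring names the SURVIVING end-type pairs (realised in the atlas
in some orientation — nothing more is true at sign level).  Survivors in this part — 70: alive {ind/ind}; 71: alive {psd/ind, nsd/ind, ind/ind}; 72: alive {ind/ind}; 73: alive {ind/psd, ind/nsd, ind/ind}; 74: alive {ind/ind}; 75: alive {psd/nsd, nsd/psd, psd/ind, nsd/ind, ind/psd, ind/nsd, ind/ind} (= g6's end-cell row; no new theorem); 76: alive {psd/ind, nsd/ind, ind/ind}; 77: alive {ind/ind}; 78: alive {psd/ind, nsd/ind, ind/psd, ind/nsd, ind/ind}; 79: alive {psd/ind, nsd/ind, ind/psd, ind/nsd, ind/ind}.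
Over all `80` chambers (parts A–H): only ind/ind survives on `8` chambers; {ind/ind, ind/psd, ind/nsd} on `14`; {ind/ind, psd/ind, nsd/ind} on `14`;
{ind/ind, psd/psd, nsd/nsd} on `12`; the five cells with an indefinite end on `22`; larger sets on `10`.  Nothing here bounds anything else; `DoorA34` and the three
stubs stay OPEN; registers unchanged; nothing on `MatrixDescartes` (stmt-ValiantsHypothesis-18050) or `VP ≠ VNP` — VP≠VNP not moved.  [folklore] Descartes bookkeeping.
-/

-- `Summit.ValiantsHypothesis.ValiantsHypothesis.…` repeats a component by the D-0017 layout
-- (single-conjunct summit), which the `dupNamespace` linter flags; the name is mandated.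
set_option linter.dupNamespace false

namespace Summit.ValiantsHypothesis.ValiantsHypothesis.Theorems.LacunarySymmetroidMatrixDescartes.Census

open Polynomial Finset Matrix
open scoped BigOperators Polynomial Matrix

/-- **Null-null chamber 70** (representative `(0, 5, 8, 20)`): **the END-TYPE ROW, orientation-free** — for EVERY sorted support in this chamber a
null-null pencil (symmetric letters, `det S₀ = det S₃ = 0`) whose pair of end types (S₀, S₃) lies in {psd/psd, psd/nsd, nsd/psd, nsd/nsd, psd/ind, nsd/ind, ind/psd, ind/nsd} has at most `16` distinct positive
roots (both orientations killed: `…oriented_on_chamber70` on `S` and on `−S`, g6's `card_posRoots_le_16_of_nullNull_oppositeSignEnds_on_chamber70`); the end-type pairs LEFT at sign level are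
exactly {ind/ind} (each realised in g5's atlas by an exact fully alternating word in some orientation). [folklore] -/
theorem card_posRoots_le_16_of_nullNull_endTypes_on_chamber70 (d : Fin 4 → ℕ) (hd : StrictMono d)
    (hC : StrictMono (![2 * d 0 + d 1, 2 * d 0 + d 2, d 0 + 2 * d 1, d 0 + d 1 + d 2, 3 * d 1, d 0 + 2 * d 2, 2 * d 1 + d 2,
        2 * d 0 + d 3, d 1 + 2 * d 2, 3 * d 2, d 0 + d 1 + d 3, d 0 + d 2 + d 3, 2 * d 1 + d 3, d 1 + d 2 + d 3,
        2 * d 2 + d 3, d 0 + 2 * d 3, d 1 + 2 * d 3, d 2 + 2 * d 3] : Fin 18 → ℕ))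
    (S : Fin 4 → Matrix (Fin 3) (Fin 3) ℝ) (hS : ∀ l, (S l).IsSymm) (h0 : (S 0).det = 0) (h3 : (S 3).det = 0)
    (hcells : ((S 0).PosSemidef ∧ (S 3).PosSemidef)
      ∨ ((S 0).PosSemidef ∧ (-(S 3)).PosSemidef)
      ∨ ((-(S 0)).PosSemidef ∧ (S 3).PosSemidef)
      ∨ ((-(S 0)).PosSemidef ∧ (-(S 3)).PosSemidef)
      ∨ ((S 0).PosSemidef ∧ (¬ (S 3).PosSemidef ∧ ¬ (-(S 3)).PosSemidef))
      ∨ ((-(S 0)).PosSemidef ∧ (¬ (S 3).PosSemidef ∧ ¬ (-(S 3)).PosSemidef))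
      ∨ ((¬ (S 0).PosSemidef ∧ ¬ (-(S 0)).PosSemidef) ∧ (S 3).PosSemidef)
      ∨ ((¬ (S 0).PosSemidef ∧ ¬ (-(S 0)).PosSemidef) ∧ (-(S 3)).PosSemidef)) :
    ((Matrix.det (∑ l, ((X : ℝ[X]) ^ d l) • (S l).map C)).roots.toFinset.filter (fun t => 0 < t)).card ≤ 16 := by
  have hG := card_posRoots_le_16_of_nullNull_oppositeSignEnds_on_chamber70 d hd hC S hS h0 h3
  have hdet : ∀ l, ((fun l => -S l) l).det = -(S l).det := fun l => by simp only [Matrix.det_neg, Fintype.card_fin]; norm_num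
  have hO := card_posRoots_le_16_of_nullNull_oriented_on_chamber70 d hd hC S hS h0 h3
  have hN := card_posRoots_le_16_of_nullNull_oriented_on_chamber70 d hd hC (fun l => -S l) (fun l => (hS l).neg)
    (by rw [hdet, h0, neg_zero]) (by rw [hdet, h3, neg_zero])
  rcases hcells with ⟨a0_0, a3_0⟩ | ⟨a0_1, a3_1⟩ | ⟨a0_2, a3_2⟩ | ⟨a0_3, a3_3⟩ | ⟨a0_4, a3_4⟩ | ⟨a0_5, a3_5⟩ | ⟨a0_6, a3_6⟩ | ⟨a0_7, a3_7⟩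
  · exact card_posRoots_le_16_of_nullNull_both_orientations d hd S h0 h3 (fun h => hO h (Or.inl ⟨a0_0, a3_0⟩))
      (fun h => hN h (Or.inr (Or.inl ⟨by simpa using a0_0, by simpa using a3_0⟩)))
  · exact hG (Or.inl ⟨a0_1, a3_1⟩)
  · exact hG (Or.inr ⟨a0_2, a3_2⟩)
  · exact card_posRoots_le_16_of_nullNull_both_orientations d hd S h0 h3 (fun h => hO h (Or.inr (Or.inl ⟨a0_3, a3_3⟩)))
      (fun h => hN h (Or.inl ⟨a0_3, a3_3⟩))
  · exact card_posRoots_le_16_of_nullNull_both_orientations d hd S h0 h3 (fun h => hO h (Or.inr (Or.inr (Or.inl ⟨a0_4, a3_4⟩))))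
      (fun h => hN h (Or.inr (Or.inr (Or.inr (Or.inl ⟨by simpa using a0_4, ⟨a3_4.2, by simpa using a3_4.1⟩⟩)))))
  · exact card_posRoots_le_16_of_nullNull_both_orientations d hd S h0 h3 (fun h => hO h (Or.inr (Or.inr (Or.inr (Or.inl ⟨a0_5, a3_5⟩)))))
      (fun h => hN h (Or.inr (Or.inr (Or.inl ⟨a0_5, ⟨a3_5.2, by simpa using a3_5.1⟩⟩))))
  · exact card_posRoots_le_16_of_nullNull_both_orientations d hd S h0 h3 (fun h => hO h (Or.inr (Or.inr (Or.inr (Or.inr (Or.inl ⟨a0_6, a3_6⟩))))))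
      (fun h => hN h (Or.inr (Or.inr (Or.inr (Or.inr (Or.inr (⟨⟨a0_6.2, by simpa using a0_6.1⟩, by simpa using a3_6⟩)))))))
  · exact card_posRoots_le_16_of_nullNull_both_orientations d hd S h0 h3 (fun h => hO h (Or.inr (Or.inr (Or.inr (Or.inr (Or.inr (⟨a0_7, a3_7⟩)))))))
      (fun h => hN h (Or.inr (Or.inr (Or.inr (Or.inr (Or.inl ⟨⟨a0_7.2, by simpa using a0_7.1⟩, a3_7⟩))))))

/-- **Null-null chamber 71** (representative `(0, 7, 11, 20)`): **the END-TYPE ROW, orientation-free** — for EVERY sorted support in this chamber a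
null-null pencil (symmetric letters, `det S₀ = det S₃ = 0`) whose pair of end types (S₀, S₃) lies in {psd/psd, psd/nsd, nsd/psd, nsd/nsd, ind/psd, ind/nsd} has at most `16` distinct positive
roots (both orientations killed: `…oriented_on_chamber71` on `S` and on `−S`, g6's `card_posRoots_le_16_of_nullNull_oppositeSignEnds_on_chamber71`); the end-type pairs LEFT at sign level are
exactly {psd/ind, nsd/ind, ind/ind} (each realised in g5's atlas by an exact fully alternating word in some orientation). [folklore] -/
theorem card_posRoots_le_16_of_nullNull_endTypes_on_chamber71 (d : Fin 4 → ℕ) (hd : StrictMono d)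
    (hC : StrictMono (![2 * d 0 + d 1, 2 * d 0 + d 2, d 0 + 2 * d 1, d 0 + d 1 + d 2, 2 * d 0 + d 3, 3 * d 1, d 0 + 2 * d 2,
        2 * d 1 + d 2, d 0 + d 1 + d 3, d 1 + 2 * d 2, d 0 + d 2 + d 3, 3 * d 2, 2 * d 1 + d 3, d 1 + d 2 + d 3,
        d 0 + 2 * d 3, 2 * d 2 + d 3, d 1 + 2 * d 3, d 2 + 2 * d 3] : Fin 18 → ℕ))
    (S : Fin 4 → Matrix (Fin 3) (Fin 3) ℝ) (hS : ∀ l, (S l).IsSymm) (h0 : (S 0).det = 0) (h3 : (S 3).det = 0)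
    (hcells : ((S 0).PosSemidef ∧ (S 3).PosSemidef)
      ∨ ((S 0).PosSemidef ∧ (-(S 3)).PosSemidef)
      ∨ ((-(S 0)).PosSemidef ∧ (S 3).PosSemidef)
      ∨ ((-(S 0)).PosSemidef ∧ (-(S 3)).PosSemidef)
      ∨ ((¬ (S 0).PosSemidef ∧ ¬ (-(S 0)).PosSemidef) ∧ (S 3).PosSemidef)
      ∨ ((¬ (S 0).PosSemidef ∧ ¬ (-(S 0)).PosSemidef) ∧ (-(S 3)).PosSemidef)) :
    ((Matrix.det (∑ l, ((X : ℝ[X]) ^ d l) • (S l).map C)).roots.toFinset.filter (fun t => 0 < t)).card ≤ 16 := by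
  have hG := card_posRoots_le_16_of_nullNull_oppositeSignEnds_on_chamber71 d hd hC S hS h0 h3
  have hdet : ∀ l, ((fun l => -S l) l).det = -(S l).det := fun l => by simp only [Matrix.det_neg, Fintype.card_fin]; norm_num
  have hO := card_posRoots_le_16_of_nullNull_oriented_on_chamber71 d hd hC S hS h0 h3
  have hN := card_posRoots_le_16_of_nullNull_oriented_on_chamber71 d hd hC (fun l => -S l) (fun l => (hS l).neg)
    (by rw [hdet, h0, neg_zero]) (by rw [hdet, h3, neg_zero])
  rcases hcells with ⟨a0_0, a3_0⟩ | ⟨a0_1, a3_1⟩ | ⟨a0_2, a3_2⟩ | ⟨a0_3, a3_3⟩ | ⟨a0_4, a3_4⟩ | ⟨a0_5, a3_5⟩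
  · exact card_posRoots_le_16_of_nullNull_both_orientations d hd S h0 h3 (fun h => hO h (Or.inl ⟨a0_0, a3_0⟩))
      (fun h => hN h (Or.inr (Or.inl ⟨by simpa using a0_0, by simpa using a3_0⟩)))
  · exact hG (Or.inl ⟨a0_1, a3_1⟩)
  · exact hG (Or.inr ⟨a0_2, a3_2⟩)
  · exact card_posRoots_le_16_of_nullNull_both_orientations d hd S h0 h3 (fun h => hO h (Or.inr (Or.inl ⟨a0_3, a3_3⟩)))
      (fun h => hN h (Or.inl ⟨a0_3, a3_3⟩))
  · exact card_posRoots_le_16_of_nullNull_both_orientations d hd S h0 h3 (fun h => hO h (Or.inr (Or.inr (Or.inr (Or.inl ⟨a0_4, a3_4⟩)))))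
      (fun h => hN h (Or.inr (Or.inr (Or.inr (Or.inr (⟨⟨a0_4.2, by simpa using a0_4.1⟩, by simpa using a3_4⟩))))))
  · exact card_posRoots_le_16_of_nullNull_both_orientations d hd S h0 h3 (fun h => hO h (Or.inr (Or.inr (Or.inr (Or.inr (⟨a0_5, a3_5⟩))))))
      (fun h => hN h (Or.inr (Or.inr (Or.inr (Or.inl ⟨⟨a0_5.2, by simpa using a0_5.1⟩, a3_5⟩)))))

/-- **Null-null chamber 72** (representative `(0, 7, 16, 20)`): **the END-TYPE ROW, orientation-free** — for EVERY sorted support in this chamber a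
null-null pencil (symmetric letters, `det S₀ = det S₃ = 0`) whose pair of end types (S₀, S₃) lies in {psd/psd, psd/nsd, nsd/psd, nsd/nsd, psd/ind, nsd/ind, ind/psd, ind/nsd} has at most `16` distinct positive
roots (both orientations killed: `…oriented_on_chamber72` on `S` and on `−S`, g6's `card_posRoots_le_16_of_nullNull_sameSignEnds_on_chamber72`); the end-type pairs LEFT at sign level are
exactly {ind/ind} (each realised in g5's atlas by an exact fully alternating word in some orientation). [folklore] -/
theorem card_posRoots_le_16_of_nullNull_endTypes_on_chamber72 (d : Fin 4 → ℕ) (hd : StrictMono d)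
    (hC : StrictMono (![2 * d 0 + d 1, d 0 + 2 * d 1, 2 * d 0 + d 2, 2 * d 0 + d 3, 3 * d 1, d 0 + d 1 + d 2, d 0 + d 1 + d 3,
        2 * d 1 + d 2, d 0 + 2 * d 2, 2 * d 1 + d 3, d 0 + d 2 + d 3, d 1 + 2 * d 2, d 0 + 2 * d 3, d 1 + d 2 + d 3,
        d 1 + 2 * d 3, 3 * d 2, 2 * d 2 + d 3, d 2 + 2 * d 3] : Fin 18 → ℕ))
    (S : Fin 4 → Matrix (Fin 3) (Fin 3) ℝ) (hS : ∀ l, (S l).IsSymm) (h0 : (S 0).det = 0) (h3 : (S 3).det = 0)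
    (hcells : ((S 0).PosSemidef ∧ (S 3).PosSemidef)
      ∨ ((S 0).PosSemidef ∧ (-(S 3)).PosSemidef)
      ∨ ((-(S 0)).PosSemidef ∧ (S 3).PosSemidef)
      ∨ ((-(S 0)).PosSemidef ∧ (-(S 3)).PosSemidef)
      ∨ ((S 0).PosSemidef ∧ (¬ (S 3).PosSemidef ∧ ¬ (-(S 3)).PosSemidef))
      ∨ ((-(S 0)).PosSemidef ∧ (¬ (S 3).PosSemidef ∧ ¬ (-(S 3)).PosSemidef))
      ∨ ((¬ (S 0).PosSemidef ∧ ¬ (-(S 0)).PosSemidef) ∧ (S 3).PosSemidef)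
      ∨ ((¬ (S 0).PosSemidef ∧ ¬ (-(S 0)).PosSemidef) ∧ (-(S 3)).PosSemidef)) :
    ((Matrix.det (∑ l, ((X : ℝ[X]) ^ d l) • (S l).map C)).roots.toFinset.filter (fun t => 0 < t)).card ≤ 16 := by
  have hG := card_posRoots_le_16_of_nullNull_sameSignEnds_on_chamber72 d hd hC S hS h0 h3
  have hdet : ∀ l, ((fun l => -S l) l).det = -(S l).det := fun l => by simp only [Matrix.det_neg, Fintype.card_fin]; norm_num
  have hO := card_posRoots_le_16_of_nullNull_oriented_on_chamber72 d hd hC S hS h0 h3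
  have hN := card_posRoots_le_16_of_nullNull_oriented_on_chamber72 d hd hC (fun l => -S l) (fun l => (hS l).neg)
    (by rw [hdet, h0, neg_zero]) (by rw [hdet, h3, neg_zero])
  rcases hcells with ⟨a0_0, a3_0⟩ | ⟨a0_1, a3_1⟩ | ⟨a0_2, a3_2⟩ | ⟨a0_3, a3_3⟩ | ⟨a0_4, a3_4⟩ | ⟨a0_5, a3_5⟩ | ⟨a0_6, a3_6⟩ | ⟨a0_7, a3_7⟩
  · exact hG (Or.inl ⟨a0_0, a3_0⟩)
  · exact card_posRoots_le_16_of_nullNull_both_orientations d hd S h0 h3 (fun h => hO h (Or.inl ⟨a0_1, a3_1⟩))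
      (fun h => hN h (Or.inr (Or.inl ⟨by simpa using a0_1, a3_1⟩)))
  · exact card_posRoots_le_16_of_nullNull_both_orientations d hd S h0 h3 (fun h => hO h (Or.inr (Or.inl ⟨a0_2, a3_2⟩)))
      (fun h => hN h (Or.inl ⟨a0_2, by simpa using a3_2⟩))
  · exact hG (Or.inr ⟨a0_3, a3_3⟩)
  · exact card_posRoots_le_16_of_nullNull_both_orientations d hd S h0 h3 (fun h => hO h (Or.inr (Or.inr (Or.inl ⟨a0_4, a3_4⟩))))
      (fun h => hN h (Or.inr (Or.inr (Or.inr (Or.inl ⟨by simpa using a0_4, ⟨a3_4.2, by simpa using a3_4.1⟩⟩)))))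
  · exact card_posRoots_le_16_of_nullNull_both_orientations d hd S h0 h3 (fun h => hO h (Or.inr (Or.inr (Or.inr (Or.inl ⟨a0_5, a3_5⟩)))))
      (fun h => hN h (Or.inr (Or.inr (Or.inl ⟨a0_5, ⟨a3_5.2, by simpa using a3_5.1⟩⟩))))
  · exact card_posRoots_le_16_of_nullNull_both_orientations d hd S h0 h3 (fun h => hO h (Or.inr (Or.inr (Or.inr (Or.inr (Or.inl ⟨a0_6, a3_6⟩))))))
      (fun h => hN h (Or.inr (Or.inr (Or.inr (Or.inr (Or.inr (⟨⟨a0_6.2, by simpa using a0_6.1⟩, by simpa using a3_6⟩)))))))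
  · exact card_posRoots_le_16_of_nullNull_both_orientations d hd S h0 h3 (fun h => hO h (Or.inr (Or.inr (Or.inr (Or.inr (Or.inr (⟨a0_7, a3_7⟩)))))))
      (fun h => hN h (Or.inr (Or.inr (Or.inr (Or.inr (Or.inl ⟨⟨a0_7.2, by simpa using a0_7.1⟩, a3_7⟩))))))

/-- **Null-null chamber 73** (representative `(0, 9, 13, 20)`): **the END-TYPE ROW, orientation-free** — for EVERY sorted support in this chamber a
null-null pencil (symmetric letters, `det S₀ = det S₃ = 0`) whose pair of end types (S₀, S₃) lies in {psd/psd, psd/nsd, nsd/psd, nsd/nsd, psd/ind, nsd/ind} has at most `16` distinct positive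
roots (both orientations killed: `…oriented_on_chamber73` on `S` and on `−S`, g6's `card_posRoots_le_16_of_nullNull_oppositeSignEnds_on_chamber73`); the end-type pairs LEFT at sign level are
exactly {ind/psd, ind/nsd, ind/ind} (each realised in g5's atlas by an exact fully alternating word in some orientation). [folklore] -/
theorem card_posRoots_le_16_of_nullNull_endTypes_on_chamber73 (d : Fin 4 → ℕ) (hd : StrictMono d)
    (hC : StrictMono (![2 * d 0 + d 1, 2 * d 0 + d 2, d 0 + 2 * d 1, 2 * d 0 + d 3, d 0 + d 1 + d 2, d 0 + 2 * d 2, 3 * d 1,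
        d 0 + d 1 + d 3, 2 * d 1 + d 2, d 0 + d 2 + d 3, d 1 + 2 * d 2, 2 * d 1 + d 3, 3 * d 2, d 0 + 2 * d 3,
        d 1 + d 2 + d 3, 2 * d 2 + d 3, d 1 + 2 * d 3, d 2 + 2 * d 3] : Fin 18 → ℕ))
    (S : Fin 4 → Matrix (Fin 3) (Fin 3) ℝ) (hS : ∀ l, (S l).IsSymm) (h0 : (S 0).det = 0) (h3 : (S 3).det = 0)
    (hcells : ((S 0).PosSemidef ∧ (S 3).PosSemidef)
      ∨ ((S 0).PosSemidef ∧ (-(S 3)).PosSemidef)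
      ∨ ((-(S 0)).PosSemidef ∧ (S 3).PosSemidef)
      ∨ ((-(S 0)).PosSemidef ∧ (-(S 3)).PosSemidef)
      ∨ ((S 0).PosSemidef ∧ (¬ (S 3).PosSemidef ∧ ¬ (-(S 3)).PosSemidef))
      ∨ ((-(S 0)).PosSemidef ∧ (¬ (S 3).PosSemidef ∧ ¬ (-(S 3)).PosSemidef))) :
    ((Matrix.det (∑ l, ((X : ℝ[X]) ^ d l) • (S l).map C)).roots.toFinset.filter (fun t => 0 < t)).card ≤ 16 := by
  have hG := card_posRoots_le_16_of_nullNull_oppositeSignEnds_on_chamber73 d hd hC S hS h0 h3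
  have hdet : ∀ l, ((fun l => -S l) l).det = -(S l).det := fun l => by simp only [Matrix.det_neg, Fintype.card_fin]; norm_num
  have hO := card_posRoots_le_16_of_nullNull_oriented_on_chamber73 d hd hC S hS h0 h3
  have hN := card_posRoots_le_16_of_nullNull_oriented_on_chamber73 d hd hC (fun l => -S l) (fun l => (hS l).neg)
    (by rw [hdet, h0, neg_zero]) (by rw [hdet, h3, neg_zero])
  rcases hcells with ⟨a0_0, a3_0⟩ | ⟨a0_1, a3_1⟩ | ⟨a0_2, a3_2⟩ | ⟨a0_3, a3_3⟩ | ⟨a0_4, a3_4⟩ | ⟨a0_5, a3_5⟩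
  · exact card_posRoots_le_16_of_nullNull_both_orientations d hd S h0 h3 (fun h => hO h (Or.inl ⟨a0_0, a3_0⟩))
      (fun h => hN h (Or.inr (Or.inl ⟨by simpa using a0_0, by simpa using a3_0⟩)))
  · exact hG (Or.inl ⟨a0_1, a3_1⟩)
  · exact hG (Or.inr ⟨a0_2, a3_2⟩)
  · exact card_posRoots_le_16_of_nullNull_both_orientations d hd S h0 h3 (fun h => hO h (Or.inr (Or.inl ⟨a0_3, a3_3⟩)))
      (fun h => hN h (Or.inl ⟨a0_3, a3_3⟩))
  · exact card_posRoots_le_16_of_nullNull_both_orientations d hd S h0 h3 (fun h => hO h (Or.inr (Or.inr (Or.inl ⟨a0_4, a3_4⟩))))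
      (fun h => hN h (Or.inr (Or.inr (Or.inr (Or.inl ⟨by simpa using a0_4, ⟨a3_4.2, by simpa using a3_4.1⟩⟩)))))
  · exact card_posRoots_le_16_of_nullNull_both_orientations d hd S h0 h3 (fun h => hO h (Or.inr (Or.inr (Or.inr (Or.inl ⟨a0_5, a3_5⟩)))))
      (fun h => hN h (Or.inr (Or.inr (Or.inl ⟨a0_5, ⟨a3_5.2, by simpa using a3_5.1⟩⟩))))

/-- **Null-null chamber 74** (representative `(0, 12, 15, 20)`): **the END-TYPE ROW, orientation-free** — for EVERY sorted support in this chamber a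
null-null pencil (symmetric letters, `det S₀ = det S₃ = 0`) whose pair of end types (S₀, S₃) lies in {psd/psd, psd/nsd, nsd/psd, nsd/nsd, psd/ind, nsd/ind, ind/psd, ind/nsd} has at most `16` distinct positive
roots (both orientations killed: `…oriented_on_chamber74` on `S` and on `−S`, g6's `card_posRoots_le_16_of_nullNull_oppositeSignEnds_on_chamber74`); the end-type pairs LEFT at sign level are
exactly {ind/ind} (each realised in g5's atlas by an exact fully alternating word in some orientation). [folklore] -/
theorem card_posRoots_le_16_of_nullNull_endTypes_on_chamber74 (d : Fin 4 → ℕ) (hd : StrictMono d)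
    (hC : StrictMono (![2 * d 0 + d 1, 2 * d 0 + d 2, 2 * d 0 + d 3, d 0 + 2 * d 1, d 0 + d 1 + d 2, d 0 + 2 * d 2, d 0 + d 1 + d 3,
        d 0 + d 2 + d 3, 3 * d 1, 2 * d 1 + d 2, d 0 + 2 * d 3, d 1 + 2 * d 2, 2 * d 1 + d 3, 3 * d 2,
        d 1 + d 2 + d 3, 2 * d 2 + d 3, d 1 + 2 * d 3, d 2 + 2 * d 3] : Fin 18 → ℕ))
    (S : Fin 4 → Matrix (Fin 3) (Fin 3) ℝ) (hS : ∀ l, (S l).IsSymm) (h0 : (S 0).det = 0) (h3 : (S 3).det = 0)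
    (hcells : ((S 0).PosSemidef ∧ (S 3).PosSemidef)
      ∨ ((S 0).PosSemidef ∧ (-(S 3)).PosSemidef)
      ∨ ((-(S 0)).PosSemidef ∧ (S 3).PosSemidef)
      ∨ ((-(S 0)).PosSemidef ∧ (-(S 3)).PosSemidef)
      ∨ ((S 0).PosSemidef ∧ (¬ (S 3).PosSemidef ∧ ¬ (-(S 3)).PosSemidef))
      ∨ ((-(S 0)).PosSemidef ∧ (¬ (S 3).PosSemidef ∧ ¬ (-(S 3)).PosSemidef))
      ∨ ((¬ (S 0).PosSemidef ∧ ¬ (-(S 0)).PosSemidef) ∧ (S 3).PosSemidef)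
      ∨ ((¬ (S 0).PosSemidef ∧ ¬ (-(S 0)).PosSemidef) ∧ (-(S 3)).PosSemidef)) :
    ((Matrix.det (∑ l, ((X : ℝ[X]) ^ d l) • (S l).map C)).roots.toFinset.filter (fun t => 0 < t)).card ≤ 16 := by
  have hG := card_posRoots_le_16_of_nullNull_oppositeSignEnds_on_chamber74 d hd hC S hS h0 h3
  have hdet : ∀ l, ((fun l => -S l) l).det = -(S l).det := fun l => by simp only [Matrix.det_neg, Fintype.card_fin]; norm_num
  have hO := card_posRoots_le_16_of_nullNull_oriented_on_chamber74 d hd hC S hS h0 h3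
  have hN := card_posRoots_le_16_of_nullNull_oriented_on_chamber74 d hd hC (fun l => -S l) (fun l => (hS l).neg)
    (by rw [hdet, h0, neg_zero]) (by rw [hdet, h3, neg_zero])
  rcases hcells with ⟨a0_0, a3_0⟩ | ⟨a0_1, a3_1⟩ | ⟨a0_2, a3_2⟩ | ⟨a0_3, a3_3⟩ | ⟨a0_4, a3_4⟩ | ⟨a0_5, a3_5⟩ | ⟨a0_6, a3_6⟩ | ⟨a0_7, a3_7⟩
  · exact card_posRoots_le_16_of_nullNull_both_orientations d hd S h0 h3 (fun h => hO h (Or.inl ⟨a0_0, a3_0⟩))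
      (fun h => hN h (Or.inr (Or.inl ⟨by simpa using a0_0, by simpa using a3_0⟩)))
  · exact hG (Or.inl ⟨a0_1, a3_1⟩)
  · exact hG (Or.inr ⟨a0_2, a3_2⟩)
  · exact card_posRoots_le_16_of_nullNull_both_orientations d hd S h0 h3 (fun h => hO h (Or.inr (Or.inl ⟨a0_3, a3_3⟩)))
      (fun h => hN h (Or.inl ⟨a0_3, a3_3⟩))
  · exact card_posRoots_le_16_of_nullNull_both_orientations d hd S h0 h3 (fun h => hO h (Or.inr (Or.inr (Or.inl ⟨a0_4, a3_4⟩))))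
      (fun h => hN h (Or.inr (Or.inr (Or.inr (Or.inl ⟨by simpa using a0_4, ⟨a3_4.2, by simpa using a3_4.1⟩⟩)))))
  · exact card_posRoots_le_16_of_nullNull_both_orientations d hd S h0 h3 (fun h => hO h (Or.inr (Or.inr (Or.inr (Or.inl ⟨a0_5, a3_5⟩)))))
      (fun h => hN h (Or.inr (Or.inr (Or.inl ⟨a0_5, ⟨a3_5.2, by simpa using a3_5.1⟩⟩))))
  · exact card_posRoots_le_16_of_nullNull_both_orientations d hd S h0 h3 (fun h => hO h (Or.inr (Or.inr (Or.inr (Or.inr (Or.inl ⟨a0_6, a3_6⟩))))))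
      (fun h => hN h (Or.inr (Or.inr (Or.inr (Or.inr (Or.inr (⟨⟨a0_6.2, by simpa using a0_6.1⟩, by simpa using a3_6⟩)))))))
  · exact card_posRoots_le_16_of_nullNull_both_orientations d hd S h0 h3 (fun h => hO h (Or.inr (Or.inr (Or.inr (Or.inr (Or.inr (⟨a0_7, a3_7⟩)))))))
      (fun h => hN h (Or.inr (Or.inr (Or.inr (Or.inr (Or.inl ⟨⟨a0_7.2, by simpa using a0_7.1⟩, a3_7⟩))))))

/-- **Null-null chamber 76** (representative `(0, 13, 15, 20)`): **the END-TYPE ROW, orientation-free** — for EVERY sorted support in this chamber a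
null-null pencil (symmetric letters, `det S₀ = det S₃ = 0`) whose pair of end types (S₀, S₃) lies in {psd/psd, psd/nsd, nsd/psd, nsd/nsd, ind/psd, ind/nsd} has at most `16` distinct positive
roots (both orientations killed: `…oriented_on_chamber76` on `S` and on `−S`, g6's `card_posRoots_le_16_of_nullNull_sameSignEnds_on_chamber76`); the end-type pairs LEFT at sign level are
exactly {psd/ind, nsd/ind, ind/ind} (each realised in g5's atlas by an exact fully alternating word in some orientation). [folklore] -/
theorem card_posRoots_le_16_of_nullNull_endTypes_on_chamber76 (d : Fin 4 → ℕ) (hd : StrictMono d)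
    (hC : StrictMono (![2 * d 0 + d 1, 2 * d 0 + d 2, 2 * d 0 + d 3, d 0 + 2 * d 1, d 0 + d 1 + d 2, d 0 + 2 * d 2, d 0 + d 1 + d 3,
        d 0 + d 2 + d 3, 3 * d 1, d 0 + 2 * d 3, 2 * d 1 + d 2, d 1 + 2 * d 2, 3 * d 2, 2 * d 1 + d 3,
        d 1 + d 2 + d 3, 2 * d 2 + d 3, d 1 + 2 * d 3, d 2 + 2 * d 3] : Fin 18 → ℕ))
    (S : Fin 4 → Matrix (Fin 3) (Fin 3) ℝ) (hS : ∀ l, (S l).IsSymm) (h0 : (S 0).det = 0) (h3 : (S 3).det = 0)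
    (hcells : ((S 0).PosSemidef ∧ (S 3).PosSemidef)
      ∨ ((S 0).PosSemidef ∧ (-(S 3)).PosSemidef)
      ∨ ((-(S 0)).PosSemidef ∧ (S 3).PosSemidef)
      ∨ ((-(S 0)).PosSemidef ∧ (-(S 3)).PosSemidef)
      ∨ ((¬ (S 0).PosSemidef ∧ ¬ (-(S 0)).PosSemidef) ∧ (S 3).PosSemidef)
      ∨ ((¬ (S 0).PosSemidef ∧ ¬ (-(S 0)).PosSemidef) ∧ (-(S 3)).PosSemidef)) :
    ((Matrix.det (∑ l, ((X : ℝ[X]) ^ d l) • (S l).map C)).roots.toFinset.filter (fun t => 0 < t)).card ≤ 16 := by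
  have hG := card_posRoots_le_16_of_nullNull_sameSignEnds_on_chamber76 d hd hC S hS h0 h3
  have hdet : ∀ l, ((fun l => -S l) l).det = -(S l).det := fun l => by simp only [Matrix.det_neg, Fintype.card_fin]; norm_num
  have hO := card_posRoots_le_16_of_nullNull_oriented_on_chamber76 d hd hC S hS h0 h3
  have hN := card_posRoots_le_16_of_nullNull_oriented_on_chamber76 d hd hC (fun l => -S l) (fun l => (hS l).neg)
    (by rw [hdet, h0, neg_zero]) (by rw [hdet, h3, neg_zero])
  rcases hcells with ⟨a0_0, a3_0⟩ | ⟨a0_1, a3_1⟩ | ⟨a0_2, a3_2⟩ | ⟨a0_3, a3_3⟩ | ⟨a0_4, a3_4⟩ | ⟨a0_5, a3_5⟩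
  · exact hG (Or.inl ⟨a0_0, a3_0⟩)
  · exact card_posRoots_le_16_of_nullNull_both_orientations d hd S h0 h3 (fun h => hO h (Or.inl ⟨a0_1, a3_1⟩))
      (fun h => hN h (Or.inr (Or.inl ⟨by simpa using a0_1, a3_1⟩)))
  · exact card_posRoots_le_16_of_nullNull_both_orientations d hd S h0 h3 (fun h => hO h (Or.inr (Or.inl ⟨a0_2, a3_2⟩)))
      (fun h => hN h (Or.inl ⟨a0_2, by simpa using a3_2⟩))
  · exact hG (Or.inr ⟨a0_3, a3_3⟩)
  · exact card_posRoots_le_16_of_nullNull_both_orientations d hd S h0 h3 (fun h => hO h (Or.inr (Or.inr (Or.inr (Or.inl ⟨a0_4, a3_4⟩)))))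
      (fun h => hN h (Or.inr (Or.inr (Or.inr (Or.inr (⟨⟨a0_4.2, by simpa using a0_4.1⟩, by simpa using a3_4⟩))))))
  · exact card_posRoots_le_16_of_nullNull_both_orientations d hd S h0 h3 (fun h => hO h (Or.inr (Or.inr (Or.inr (Or.inr (⟨a0_5, a3_5⟩))))))
      (fun h => hN h (Or.inr (Or.inr (Or.inr (Or.inl ⟨⟨a0_5.2, by simpa using a0_5.1⟩, a3_5⟩)))))

/-- **Null-null chamber 77** (representative `(0, 13, 18, 20)`): **the END-TYPE ROW, orientation-free** — for EVERY sorted support in this chamber a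
null-null pencil (symmetric letters, `det S₀ = det S₃ = 0`) whose pair of end types (S₀, S₃) lies in {psd/psd, psd/nsd, nsd/psd, nsd/nsd, psd/ind, nsd/ind, ind/psd, ind/nsd} has at most `16` distinct positive
roots (both orientations killed: `…oriented_on_chamber77` on `S` and on `−S`, g6's `card_posRoots_le_16_of_nullNull_sameSignEnds_on_chamber77`); the end-type pairs LEFT at sign level are
exactly {ind/ind} (each realised in g5's atlas by an exact fully alternating word in some orientation). [folklore] -/
theorem card_posRoots_le_16_of_nullNull_endTypes_on_chamber77 (d : Fin 4 → ℕ) (hd : StrictMono d)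
    (hC : StrictMono (![2 * d 0 + d 1, 2 * d 0 + d 2, 2 * d 0 + d 3, d 0 + 2 * d 1, d 0 + d 1 + d 2, d 0 + d 1 + d 3, d 0 + 2 * d 2,
        d 0 + d 2 + d 3, 3 * d 1, d 0 + 2 * d 3, 2 * d 1 + d 2, 2 * d 1 + d 3, d 1 + 2 * d 2, d 1 + d 2 + d 3,
        d 1 + 2 * d 3, 3 * d 2, 2 * d 2 + d 3, d 2 + 2 * d 3] : Fin 18 → ℕ))
    (S : Fin 4 → Matrix (Fin 3) (Fin 3) ℝ) (hS : ∀ l, (S l).IsSymm) (h0 : (S 0).det = 0) (h3 : (S 3).det = 0)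
    (hcells : ((S 0).PosSemidef ∧ (S 3).PosSemidef)
      ∨ ((S 0).PosSemidef ∧ (-(S 3)).PosSemidef)
      ∨ ((-(S 0)).PosSemidef ∧ (S 3).PosSemidef)
      ∨ ((-(S 0)).PosSemidef ∧ (-(S 3)).PosSemidef)
      ∨ ((S 0).PosSemidef ∧ (¬ (S 3).PosSemidef ∧ ¬ (-(S 3)).PosSemidef))
      ∨ ((-(S 0)).PosSemidef ∧ (¬ (S 3).PosSemidef ∧ ¬ (-(S 3)).PosSemidef))
      ∨ ((¬ (S 0).PosSemidef ∧ ¬ (-(S 0)).PosSemidef) ∧ (S 3).PosSemidef)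
      ∨ ((¬ (S 0).PosSemidef ∧ ¬ (-(S 0)).PosSemidef) ∧ (-(S 3)).PosSemidef)) :
    ((Matrix.det (∑ l, ((X : ℝ[X]) ^ d l) • (S l).map C)).roots.toFinset.filter (fun t => 0 < t)).card ≤ 16 := by
  have hG := card_posRoots_le_16_of_nullNull_sameSignEnds_on_chamber77 d hd hC S hS h0 h3
  have hdet : ∀ l, ((fun l => -S l) l).det = -(S l).det := fun l => by simp only [Matrix.det_neg, Fintype.card_fin]; norm_num
  have hO := card_posRoots_le_16_of_nullNull_oriented_on_chamber77 d hd hC S hS h0 h3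
  have hN := card_posRoots_le_16_of_nullNull_oriented_on_chamber77 d hd hC (fun l => -S l) (fun l => (hS l).neg)
    (by rw [hdet, h0, neg_zero]) (by rw [hdet, h3, neg_zero])
  rcases hcells with ⟨a0_0, a3_0⟩ | ⟨a0_1, a3_1⟩ | ⟨a0_2, a3_2⟩ | ⟨a0_3, a3_3⟩ | ⟨a0_4, a3_4⟩ | ⟨a0_5, a3_5⟩ | ⟨a0_6, a3_6⟩ | ⟨a0_7, a3_7⟩
  · exact hG (Or.inl ⟨a0_0, a3_0⟩)
  · exact card_posRoots_le_16_of_nullNull_both_orientations d hd S h0 h3 (fun h => hO h (Or.inl ⟨a0_1, a3_1⟩))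
      (fun h => hN h (Or.inr (Or.inl ⟨by simpa using a0_1, a3_1⟩)))
  · exact card_posRoots_le_16_of_nullNull_both_orientations d hd S h0 h3 (fun h => hO h (Or.inr (Or.inl ⟨a0_2, a3_2⟩)))
      (fun h => hN h (Or.inl ⟨a0_2, by simpa using a3_2⟩))
  · exact hG (Or.inr ⟨a0_3, a3_3⟩)
  · exact card_posRoots_le_16_of_nullNull_both_orientations d hd S h0 h3 (fun h => hO h (Or.inr (Or.inr (Or.inl ⟨a0_4, a3_4⟩))))
      (fun h => hN h (Or.inr (Or.inr (Or.inr (Or.inl ⟨by simpa using a0_4, ⟨a3_4.2, by simpa using a3_4.1⟩⟩)))))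
  · exact card_posRoots_le_16_of_nullNull_both_orientations d hd S h0 h3 (fun h => hO h (Or.inr (Or.inr (Or.inr (Or.inl ⟨a0_5, a3_5⟩)))))
      (fun h => hN h (Or.inr (Or.inr (Or.inl ⟨a0_5, ⟨a3_5.2, by simpa using a3_5.1⟩⟩))))
  · exact card_posRoots_le_16_of_nullNull_both_orientations d hd S h0 h3 (fun h => hO h (Or.inr (Or.inr (Or.inr (Or.inr (Or.inl ⟨a0_6, a3_6⟩))))))
      (fun h => hN h (Or.inr (Or.inr (Or.inr (Or.inr (Or.inr (⟨⟨a0_6.2, by simpa using a0_6.1⟩, by simpa using a3_6⟩)))))))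
  · exact card_posRoots_le_16_of_nullNull_both_orientations d hd S h0 h3 (fun h => hO h (Or.inr (Or.inr (Or.inr (Or.inr (Or.inr (⟨a0_7, a3_7⟩)))))))
      (fun h => hN h (Or.inr (Or.inr (Or.inr (Or.inr (Or.inl ⟨⟨a0_7.2, by simpa using a0_7.1⟩, a3_7⟩))))))

/-- **Null-null chamber 78** (representative `(0, 7, 10, 22)`): **the END-TYPE ROW, orientation-free** — for EVERY sorted support in this chamber a
null-null pencil (symmetric letters, `det S₀ = det S₃ = 0`) whose pair of end types (S₀, S₃) lies in {psd/psd, psd/nsd, nsd/psd, nsd/nsd} has at most `16` distinct positive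
roots (both orientations killed: `…oriented_on_chamber78` on `S` and on `−S`, g6's `card_posRoots_le_16_of_nullNull_sameSignEnds_on_chamber78`); the end-type pairs LEFT at sign level are
exactly {psd/ind, nsd/ind, ind/psd, ind/nsd, ind/ind} (each realised in g5's atlas by an exact fully alternating word in some orientation). [folklore] -/
theorem card_posRoots_le_16_of_nullNull_endTypes_on_chamber78 (d : Fin 4 → ℕ) (hd : StrictMono d)
    (hC : StrictMono (![2 * d 0 + d 1, 2 * d 0 + d 2, d 0 + 2 * d 1, d 0 + d 1 + d 2, d 0 + 2 * d 2, 3 * d 1, 2 * d 0 + d 3,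
        2 * d 1 + d 2, d 1 + 2 * d 2, d 0 + d 1 + d 3, 3 * d 2, d 0 + d 2 + d 3, 2 * d 1 + d 3, d 1 + d 2 + d 3,
        2 * d 2 + d 3, d 0 + 2 * d 3, d 1 + 2 * d 3, d 2 + 2 * d 3] : Fin 18 → ℕ))
    (S : Fin 4 → Matrix (Fin 3) (Fin 3) ℝ) (hS : ∀ l, (S l).IsSymm) (h0 : (S 0).det = 0) (h3 : (S 3).det = 0)
    (hcells : ((S 0).PosSemidef ∧ (S 3).PosSemidef)
      ∨ ((S 0).PosSemidef ∧ (-(S 3)).PosSemidef)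
      ∨ ((-(S 0)).PosSemidef ∧ (S 3).PosSemidef)
      ∨ ((-(S 0)).PosSemidef ∧ (-(S 3)).PosSemidef)) :
    ((Matrix.det (∑ l, ((X : ℝ[X]) ^ d l) • (S l).map C)).roots.toFinset.filter (fun t => 0 < t)).card ≤ 16 := by
  have hG := card_posRoots_le_16_of_nullNull_sameSignEnds_on_chamber78 d hd hC S hS h0 h3
  have hdet : ∀ l, ((fun l => -S l) l).det = -(S l).det := fun l => by simp only [Matrix.det_neg, Fintype.card_fin]; norm_num
  have hO := card_posRoots_le_16_of_nullNull_oriented_on_chamber78 d hd hC S hS h0 h3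
  have hN := card_posRoots_le_16_of_nullNull_oriented_on_chamber78 d hd hC (fun l => -S l) (fun l => (hS l).neg)
    (by rw [hdet, h0, neg_zero]) (by rw [hdet, h3, neg_zero])
  rcases hcells with ⟨a0_0, a3_0⟩ | ⟨a0_1, a3_1⟩ | ⟨a0_2, a3_2⟩ | ⟨a0_3, a3_3⟩
  · exact hG (Or.inl ⟨a0_0, a3_0⟩)
  · exact card_posRoots_le_16_of_nullNull_both_orientations d hd S h0 h3 (fun h => hO h (Or.inl ⟨a0_1, a3_1⟩))
      (fun h => hN h (Or.inr (Or.inl ⟨by simpa using a0_1, a3_1⟩)))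
  · exact card_posRoots_le_16_of_nullNull_both_orientations d hd S h0 h3 (fun h => hO h (Or.inr (Or.inl ⟨a0_2, a3_2⟩)))
      (fun h => hN h (Or.inl ⟨a0_2, by simpa using a3_2⟩))
  · exact hG (Or.inr ⟨a0_3, a3_3⟩)

/-- **Null-null chamber 79** (representative `(0, 12, 15, 22)`): **the END-TYPE ROW, orientation-free** — for EVERY sorted support in this chamber a
null-null pencil (symmetric letters, `det S₀ = det S₃ = 0`) whose pair of end types (S₀, S₃) lies in {psd/psd, psd/nsd, nsd/psd, nsd/nsd} has at most `16` distinct positive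
roots (both orientations killed: `…oriented_on_chamber79` on `S` and on `−S`, g6's `card_posRoots_le_16_of_nullNull_sameSignEnds_on_chamber79`); the end-type pairs LEFT at sign level are
exactly {psd/ind, nsd/ind, ind/psd, ind/nsd, ind/ind} (each realised in g5's atlas by an exact fully alternating word in some orientation). [folklore] -/
theorem card_posRoots_le_16_of_nullNull_endTypes_on_chamber79 (d : Fin 4 → ℕ) (hd : StrictMono d)
    (hC : StrictMono (![2 * d 0 + d 1, 2 * d 0 + d 2, 2 * d 0 + d 3, d 0 + 2 * d 1, d 0 + d 1 + d 2, d 0 + 2 * d 2, d 0 + d 1 + d 3,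
        3 * d 1, d 0 + d 2 + d 3, 2 * d 1 + d 2, d 1 + 2 * d 2, d 0 + 2 * d 3, 3 * d 2, 2 * d 1 + d 3,
        d 1 + d 2 + d 3, 2 * d 2 + d 3, d 1 + 2 * d 3, d 2 + 2 * d 3] : Fin 18 → ℕ))
    (S : Fin 4 → Matrix (Fin 3) (Fin 3) ℝ) (hS : ∀ l, (S l).IsSymm) (h0 : (S 0).det = 0) (h3 : (S 3).det = 0)
    (hcells : ((S 0).PosSemidef ∧ (S 3).PosSemidef)
      ∨ ((S 0).PosSemidef ∧ (-(S 3)).PosSemidef)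
      ∨ ((-(S 0)).PosSemidef ∧ (S 3).PosSemidef)
      ∨ ((-(S 0)).PosSemidef ∧ (-(S 3)).PosSemidef)) :
    ((Matrix.det (∑ l, ((X : ℝ[X]) ^ d l) • (S l).map C)).roots.toFinset.filter (fun t => 0 < t)).card ≤ 16 := by
  have hG := card_posRoots_le_16_of_nullNull_sameSignEnds_on_chamber79 d hd hC S hS h0 h3
  have hdet : ∀ l, ((fun l => -S l) l).det = -(S l).det := fun l => by simp only [Matrix.det_neg, Fintype.card_fin]; norm_num
  have hO := card_posRoots_le_16_of_nullNull_oriented_on_chamber79 d hd hC S hS h0 h3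
  have hN := card_posRoots_le_16_of_nullNull_oriented_on_chamber79 d hd hC (fun l => -S l) (fun l => (hS l).neg)
    (by rw [hdet, h0, neg_zero]) (by rw [hdet, h3, neg_zero])
  rcases hcells with ⟨a0_0, a3_0⟩ | ⟨a0_1, a3_1⟩ | ⟨a0_2, a3_2⟩ | ⟨a0_3, a3_3⟩
  · exact hG (Or.inl ⟨a0_0, a3_0⟩)
  · exact card_posRoots_le_16_of_nullNull_both_orientations d hd S h0 h3 (fun h => hO h (Or.inl ⟨a0_1, a3_1⟩))
      (fun h => hN h (Or.inr (Or.inl ⟨by simpa using a0_1, a3_1⟩)))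
  · exact card_posRoots_le_16_of_nullNull_both_orientations d hd S h0 h3 (fun h => hO h (Or.inr (Or.inl ⟨a0_2, a3_2⟩)))
      (fun h => hN h (Or.inl ⟨a0_2, by simpa using a3_2⟩))
  · exact hG (Or.inr ⟨a0_3, a3_3⟩)

end Summit.ValiantsHypothesis.ValiantsHypothesis.Theorems.LacunarySymmetroidMatrixDescartes.Census

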